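import Literature.Combinatorics.Optimization.CardinalityCyclePolytopeEF
import Literature.Barriers.PneNP.SubsetSumPolytopeXCLowerBound
import HarnessLib

/-!
# The pseudo-polynomial extended formulation of the knapsack polytope by dynamic programming
# (Conforti–Cornuéjols–Zambelli 2013, §7.1, Theorem 7.1) — PROVED

M. Conforti, G. Cornuéjols, G. Zambelli, *Extended formulations in combinatorial optimization*,
Ann. Oper. Res. 204 (2013) 97–143 [ConfortiCornuejolsZambelli2013] (held text
`paper:doi-10-1007-s10479-012-1269-0`, §7 "Dynamic Programming", §7.1 "The knapsack problem",
p0033 L73–p0034 L20), verbatim: "The `0−1` knapsack set `K(n, b)` with `n` items and capacity `b`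
[§5.3: `K(n,b) = {x ∈ {0,1}ⁿ : Σ_i a_i x_i ≤ b}`] … For `k ≤ n` and `0 ≤ b' ≤ b`, let `f(k, b')` be the
optimal value of the knapsack problem over the set `K(k, b')` and using the first `k` items: Then
`f(k, b')` can be computed using the following recursion: `f(k, b') = max{f(k−1, b'), f(k−1, b'−a_k) + c_k}`.
Consider the acyclic network `N(V, A)`, where the vertices `v_{k,b'}` represent all possible states
`f(k, b')`, `0 ≤ k ≤ n`, `0 ≤ b' ≤ b` and the edges are `v_{k−1,b'} v_{k,b'}` having weight `0` and
`v_{k−1,b'−a_k} v_{k,b'}` having weight `c_k`. We call `A_k` the set of arcs with weight `c_k`. … Note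
that `x_k = 1` if `P ∩ A_k ≠ ∅`. Consider the polyhedron `Q` defined by the following inequalities:
`x_k = Σ_{a ∈ A_k} z_a` (`1 ≤ k ≤ n`); [flow conservation: one unit out of `v_{0,0}`, one unit into
`v_{n,b}`, balance at the other nodes]; `z_a ≥ 0`, `a ∈ A`.
**Theorem 7.1.** Let `K(n, b) = {x ∈ {0,1}ⁿ : Σ_{i=1}^n a_i x_i ≤ b}`. Then `conv(K(n, b)) = proj_x(Q)`.
Proof. In the system of inequalities defining `Q`, disregard the first set of equations, that define
`x_k`. The remaining system is the path polytope, since `D = (V, A)` does not contain directed cycles."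

## What is proved (no named facts), and the two deviations from print

The knapsack polytope is the tree's `Literature.Barriers.PneNP.knapsackPolytope a b`
(`= conv{assignVec y : selSum a y ≤ b}`, Avis–Tiwary's `KNAPSACK(A,b)`, `SubsetSumPolytopeXCLowerBound`).
The DP digraph is an instance of `AcyclicFlow` (flow decomposition, Korte–Vygen Thm. 8.8, and the
sharp count `hasEFOfSize_convexHull_of_pathImage`): states `KState n b = Fin (n+1) × Fin (b+1) × Bool`
— level `k`, accumulated weight `s ≤ b`, and ONE EXTRA BIT recording whether the last item was taken
(deviation (i): the printed network has parallel arcs `v_{k−1,b'} v_{k,b'}` of both kinds when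
`a_k = 0`; the tree's arc space has one variable per ORDERED PAIR of states, so the bit separates "skip"
from "take"); arcs `s → (0,0,ff)`, `(k,s,·) → (k+1,s,ff)` (skip), `(k,s,·) → (k+1,s+a_k,tt)` (take,
if `s + a_k ≤ b`), and `(n,s,·) → t` for EVERY `s ≤ b` (deviation (ii): the printed `Q` routes one
unit into `v_{n,b}`; with the printed weight-preserving "skip" arcs only the paths of total weight
EXACTLY `b` reach `v_{n,b}` — which yields `conv{x : Σ a_i x_i = b} = SUBSETSUM(A,b)`; letting every
`v_{n,b'}` be terminal gives `Σ a_i x_i ≤ b` as stated in Theorem 7.1; the subset-sum polytope is then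
recovered as a face, `HasEFOfSize.subsetSum_of_knapsack`).  The projection is the printed
`x_k = Σ_{a ∈ A_k} z_a` (`proj`).

* `proj_image_pathVecs` — the `s`–`t` paths of the DP digraph project exactly onto
  `{assignVec y : selSum a y ≤ b}` ("Note that `x_k = 1` if `P ∩ A_k ≠ ∅`", both directions);
* `card_dag_le` — the digraph has at most `8(n+1)(b+1)` arcs;
* **`hasEFOfSize_knapsackPolytope_fin`**, **`ConfortiCornuejolsZambelli2013_thm71`** (any finite item
  type): `xc(KNAPSACK(A,b)) ≤ 8(|A|+1)(b+1)` — pseudo-polynomial; **`hasEFOfSize_subsetSumPolytope`** —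
  the same for `SUBSETSUM(A,b)`;
* **`AvisTiwary2015_target_exponential`** — consequently the Avis–Tiwary instances with
  `xc ≥ (3/2)ⁿ − 1` (`AvisTiwary2015_cor2`, `10(n+1)² − 8(n+1)` items) have capacity
  `b ≥ ((3/2)ⁿ − 1)/(8·(10(n+1)²−8(n+1)+1)) − 1`: extension-complexity lower bounds for knapsack /
  subset-sum polytopes must use exponentially large weights. [cite: AvisTiwary2015, Cor. 2 (arXiv p. 9)]

## References

* [ConfortiCornuejolsZambelli2013] loc. cit., doi:10.1007/s10479-012-1269-0, §7.1 Thm. 7.1 (pp. 33–34).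
* [AvisTiwary2015] D. Avis, H. R. Tiwary, *On the extension complexity of combinatorial polytopes*,
  Math. Program. 153 (2015), §3.2 Thm. 6 / Cor. 2 (arXiv:1302.2340 pp. 8–9).
* [KorteVygen2018] Thm. 8.8 (flow decomposition) — `AcyclicFlowDecomposition`.
-/

noncomputable section

open Finset Function

namespace Literature.Combinatorics.Optimization

namespace KnapsackEF

open AcyclicFlow
open Literature.Barriers.PneNP (HasEFOfSize assignVec selSum knapsackPolytope subsetSumPolytope)

variable {n b : ℕ}

/-! ## §1. The DP digraph -/

/-- DP states `(k, s, t)`: `k` items decided, accumulated weight `s ≤ b`, `t` = "the `k`-th item was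
taken" (`ff` at `k = 0`). [cite: ConfortiCornuejolsZambelli2013, §7.1 (p. 34: "the vertices `v_{k,b'}` represent all possible states")] -/
abbrev KState (n b : ℕ) : Type := Fin (n + 1) × Fin (b + 1) × Bool

/-- `|KState n b| = 2(n+1)(b+1)`. [cite: ConfortiCornuejolsZambelli2013, §7.1 (p. 34)] -/
theorem card_kState (n b : ℕ) : Fintype.card (KState n b) = 2 * (n + 1) * (b + 1) := by
  simp only [KState, Fintype.card_prod, Fintype.card_fin, Fintype.card_bool]
  ring

/-- The arcs: `s → (0,0,ff)`; skip `(k,s,·) → (k+1,s,ff)`; take `(k,s,·) → (k+1,s+a_k,tt)`; every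
level-`n` state `→ t`. [cite: ConfortiCornuejolsZambelli2013, §7.1 (p. 34: "the edges are `v_{k−1,b'}v_{k,b'}` … and `v_{k−1,b'−a_k}v_{k,b'}`")] -/
def IsArc (w : Fin n → ℕ) : FlowArc (KState n b) → Prop
  | Sum.inl x => x = (0, 0, false)
  | Sum.inr (Sum.inl q) => q.2.1.val = q.1.1.val + 1 ∧
      ((q.2.2.2 = false ∧ q.2.2.1.val = q.1.2.1.val) ∨
        (q.2.2.2 = true ∧ ∃ h : q.1.1.val < n, q.2.2.1.val = q.1.2.1.val + w ⟨q.1.1.val, h⟩))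
  | Sum.inr (Sum.inr x) => x.1.val = n

/-- The arc set of the DP digraph. [cite: ConfortiCornuejolsZambelli2013, §7.1 (p. 34)] -/
def dag (w : Fin n → ℕ) (b : ℕ) : Finset (FlowArc (KState n b)) := by
  classical exact univ.filter (IsArc w)

variable {w : Fin n → ℕ}

/-- Membership in `dag`. [cite: ConfortiCornuejolsZambelli2013, §7.1 (p. 34)] -/
theorem mem_dag {a : FlowArc (KState n b)} : a ∈ dag w b ↔ IsArc w a := by
  classical
  unfold dag
  simp

/-- Source arcs. [cite: ConfortiCornuejolsZambelli2013, §7.1 (p. 34)] -/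
@[simp] theorem isArc_srcA (x : KState n b) : IsArc w (srcA x) ↔ x = (0, 0, false) := Iff.rfl

/-- Inner arcs. [cite: ConfortiCornuejolsZambelli2013, §7.1 (p. 34)] -/
@[simp] theorem isArc_arcA (x y : KState n b) :
    IsArc w (arcA x y) ↔ y.1.val = x.1.val + 1 ∧
      ((y.2.2 = false ∧ y.2.1.val = x.2.1.val) ∨
        (y.2.2 = true ∧ ∃ h : x.1.val < n, y.2.1.val = x.2.1.val + w ⟨x.1.val, h⟩)) :=
  Iff.rfl

/-- Sink arcs. [cite: ConfortiCornuejolsZambelli2013, §7.1 (p. 34)] -/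
@[simp] theorem isArc_snkA (x : KState n b) : IsArc w (snkA x) ↔ x.1.val = n := Iff.rfl

/-- The DP digraph is acyclic: graded by the level. [cite: ConfortiCornuejolsZambelli2013, §7.1 (p. 34: "acyclic network")] -/
theorem dag_graded (w : Fin n → ℕ) (b : ℕ) :
    ∀ x y : KState n b, arcA x y ∈ dag w b → x.1.val < y.1.val := by
  intro x y h
  rw [mem_dag, isArc_arcA] at h
  omega

/-- An arc of the digraph is determined by its tail, its kind, and the take-bit of its head.
[cite: ConfortiCornuejolsZambelli2013, §7.1 (p. 34)] -/
def arcKey : FlowArc (KState n b) → KState n b ⊕ (KState n b × Bool) ⊕ KState n b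
  | Sum.inl x => Sum.inl x
  | Sum.inr (Sum.inl q) => Sum.inr (Sum.inl (q.1, q.2.2.2))
  | Sum.inr (Sum.inr x) => Sum.inr (Sum.inr x)

/-- `arcKey` is injective on the digraph. [cite: ConfortiCornuejolsZambelli2013, §7.1 (p. 34)] -/
theorem arcKey_injOn (w : Fin n → ℕ) (b : ℕ) :
    Set.InjOn (arcKey (n := n) (b := b)) (dag w b : Set (FlowArc (KState n b))) := by
  intro a ha a' ha' h
  rw [Finset.mem_coe, mem_dag] at ha ha'
  rcases a with x | ⟨x, y⟩ | x <;> rcases a' with x' | ⟨x', y'⟩ | x' <;>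
    simp only [arcKey, Sum.inl.injEq, Sum.inr.injEq, Prod.mk.injEq, reduceCtorEq] at h
  · rw [h]
  · obtain ⟨rfl, hb⟩ := h
    simp only [IsArc] at ha ha'
    obtain ⟨hl, hs⟩ := ha
    obtain ⟨hl', hs'⟩ := ha'
    have h1 : y.1 = y'.1 := Fin.ext (by omega)
    have h3 : y.2.2 = y'.2.2 := hb
    have h2 : y.2.1 = y'.2.1 := by
      apply Fin.ext
      rcases hs with ⟨hf, hv⟩ | ⟨ht, ⟨hh, hv⟩⟩ <;> rcases hs' with ⟨hf', hv'⟩ | ⟨ht', ⟨hh', hv'⟩⟩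
      · omega
      · rw [hf, ht'] at h3; exact absurd h3 (by decide)
      · rw [ht, hf'] at h3; exact absurd h3 (by decide)
      · rw [hv, hv']
    rcases y with ⟨y1, y2, y3⟩
    rcases y' with ⟨y1', y2', y3'⟩
    simp only at h1 h2 h3
    rw [h1, h2, h3]
  · rw [h]

/-- **The DP digraph has `O(n·b)` arcs**: `|dag| ≤ 4·|KState| = 8(n+1)(b+1)`.
[cite: ConfortiCornuejolsZambelli2013, §7.1 (p. 34)] -/
theorem card_dag_le (w : Fin n → ℕ) (b : ℕ) : (dag w b).card ≤ 8 * (n + 1) * (b + 1) := by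
  classical
  have h := Finset.card_le_card_of_injOn (arcKey (n := n) (b := b)) (fun a _ => mem_univ (arcKey a))
    (arcKey_injOn w b)
  rw [card_univ] at h
  have e : Fintype.card (KState n b ⊕ (KState n b × Bool) ⊕ KState n b) = 8 * (n + 1) * (b + 1) := by
    simp only [Fintype.card_sum, Fintype.card_prod, Fintype.card_bool, Fintype.card_fin]
    ring
  rw [e] at h
  exact h

/-! ## §2. The projection `x_k = Σ_{a ∈ A_k} z_a` -/

/-- Coefficient of the arc `a` in `x_k`: `1` iff `a` is a take-arc into level `k+1`.
[cite: ConfortiCornuejolsZambelli2013, §7.1 (p. 34: "`x_k = Σ_{a∈A_k} z_a`")] -/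
def takeCoeff (k : Fin n) : FlowArc (KState n b) → ℝ
  | Sum.inr (Sum.inl q) => if q.2.1.val = k.val + 1 ∧ q.2.2.2 = true then 1 else 0
  | _ => 0

/-- The printed projection as a linear map. [cite: ConfortiCornuejolsZambelli2013, §7.1 (p. 34)] -/
def proj (n b : ℕ) : FlowVec (KState n b) →ₗ[ℝ] (Fin n → ℝ) :=
  (Matrix.of fun (k : Fin n) (a : FlowArc (KState n b)) => takeCoeff k a).mulVecLin

/-- Coordinates of the projection. [cite: ConfortiCornuejolsZambelli2013, §7.1 (p. 34)] -/
theorem proj_apply (f : FlowVec (KState n b)) (k : Fin n) :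
    proj n b f k = ∑ a, takeCoeff k a * f a := by
  simp [proj, Matrix.mulVec, dotProduct]

/-- The projection of a path vector: the number of take-arcs of the path into level `k+1`.
[cite: ConfortiCornuejolsZambelli2013, §7.1 (p. 34: "`x_k = 1` if `P ∩ A_k ≠ ∅`")] -/
theorem proj_pathVec {m : ℕ} (v : Fin (m + 1) → KState n b) (hinj : Injective v) (k : Fin n) :
    proj n b (pathVec ⟨m, v⟩) k =
      ∑ i : Fin m, (if (v i.succ).1.val = k.val + 1 ∧ (v i.succ).2.2 = true then (1 : ℝ) else 0) := by
  rw [proj_apply, sum_mul_pathVec v hinj]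
  simp [takeCoeff]

/-! ## §3. Paths of the DP digraph ↔ feasible knapsack solutions -/

/-- Partial sums `Σ_{j < i} [y_j] a_j`. [cite: ConfortiCornuejolsZambelli2013, §7.1 (p. 34: "using the first `k` items")] -/
def psum (w : Fin n → ℕ) (y : Fin n → Bool) (i : ℕ) : ℕ :=
  ∑ j : Fin n, if j.val < i ∧ y j = true then w j else 0

/-- `psum 0 = 0`. [cite: ConfortiCornuejolsZambelli2013, §7.1 (p. 34)] -/
theorem psum_zero (w : Fin n → ℕ) (y : Fin n → Bool) : psum w y 0 = 0 := by
  simp [psum]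

/-- `psum (i+1) = psum i + [y_i] a_i` for `i < n`. [cite: ConfortiCornuejolsZambelli2013, §7.1 (p. 34: the recursion)] -/
theorem psum_succ (w : Fin n → ℕ) (y : Fin n → Bool) (i : Fin n) :
    psum w y (i.val + 1) = psum w y i.val + (if y i = true then w i else 0) := by
  classical
  unfold psum
  have key : ∀ j : Fin n, (if j.val < i.val + 1 ∧ y j = true then w j else 0) =
      (if j.val < i.val ∧ y j = true then w j else 0) +
        (if j = i then (if y j = true then w j else 0) else 0) := by
    intro j
    by_cases hji : j = i
    · subst hji
      simp
    · have hne : j.val ≠ i.val := fun h => hji (Fin.ext h)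
      have hiff : (j.val < i.val + 1) ↔ (j.val < i.val) := by omega
      simp [hji, hiff]
  rw [Finset.sum_congr rfl (fun j _ => key j), Finset.sum_add_distrib, Finset.sum_ite_eq' univ i]
  simp

/-- `psum n = selSum`. [cite: ConfortiCornuejolsZambelli2013, §7.1 (p. 34)] -/
theorem psum_eq_selSum (w : Fin n → ℕ) (y : Fin n → Bool) : psum w y n = selSum w y := by
  unfold psum selSum
  refine Finset.sum_congr rfl fun j _ => ?_
  by_cases hy : y j = true
  · simp [hy, j.isLt]
  · simp [hy]

/-- Partial sums are monotone. [cite: ConfortiCornuejolsZambelli2013, §7.1 (p. 34)] -/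
theorem psum_le_selSum (w : Fin n → ℕ) (y : Fin n → Bool) (i : ℕ) : psum w y i ≤ selSum w y := by
  rw [← psum_eq_selSum]
  unfold psum
  refine Finset.sum_le_sum fun j _ => ?_
  by_cases hy : y j = true
  · simp only [hy, and_true, j.isLt]
    split_ifs <;> simp
  · simp [hy]

section legit

variable {m : ℕ} {v : Fin (m + 1) → KState n b}

/-- Along a path of the DP digraph the level of the `i`-th node is `i`. [cite: ConfortiCornuejolsZambelli2013, §7.1 (p. 34)] -/
theorem level_of_isPathIn (hp : IsPathIn (dag w b) ⟨m, v⟩) : ∀ i : Fin (m + 1), (v i).1.val = i.val := by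
  intro i
  induction i using Fin.induction with
  | zero =>
    have h := (isPathIn_iff.1 hp).1
    rw [mem_dag, isArc_srcA] at h
    rw [show v 0 = (0, 0, false) from h]
    rfl
  | succ i ih =>
    have h := (isPathIn_iff.1 hp).2.1 i
    rw [mem_dag, isArc_arcA] at h
    rw [h.1, ih]
    simp

/-- Hence a path has exactly `n` inner arcs. [cite: ConfortiCornuejolsZambelli2013, §7.1 (p. 34)] -/
theorem len_of_isPathIn (hp : IsPathIn (dag w b) ⟨m, v⟩) : m = n := by
  have h := (isPathIn_iff.1 hp).2.2
  rw [mem_dag, isArc_snkA, level_of_isPathIn hp] at h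
  simpa using h

end legit

/-- The selection read off a path: `y_k` = the take-bit of the node at level `k+1`. [cite: ConfortiCornuejolsZambelli2013, §7.1 (p. 34: "`x_k = 1` if `P ∩ A_k ≠ ∅`")] -/
def selOf (v : Fin (n + 1) → KState n b) : Fin n → Bool := fun k => (v k.succ).2.2

/-- **Path ⇒ solution**: for a path of the DP digraph, the accumulated weights are the partial sums of
the selection it encodes, which is therefore feasible, and the path projects to its characteristic
vector. [cite: ConfortiCornuejolsZambelli2013, §7.1, Thm. 7.1 (p. 34)] -/
theorem weight_of_isPathIn {v : Fin (n + 1) → KState n b} (hp : IsPathIn (dag w b) ⟨n, v⟩) :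
    ∀ i : Fin (n + 1), (v i).2.1.val = psum w (selOf v) i.val := by
  intro i
  induction i using Fin.induction with
  | zero =>
    have h := (isPathIn_iff.1 hp).1
    rw [mem_dag, isArc_srcA] at h
    rw [show v 0 = (0, 0, false) from h]
    simp [psum_zero]
  | succ i ih =>
    have h := (isPathIn_iff.1 hp).2.1 i
    rw [mem_dag, isArc_arcA] at h
    rw [Fin.val_castSucc] at ih
    rw [Fin.val_succ, psum_succ, ← ih]
    have hlev := level_of_isPathIn hp i.castSucc
    simp only [Fin.val_castSucc] at hlev
    rcases h.2 with ⟨hf, hv⟩ | ⟨ht, ⟨hh, hv⟩⟩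
    · rw [hv, show selOf v i = false from hf]
      simp
    · rw [hv, show selOf v i = true from ht]
      have : (⟨(v i.castSucc).1.val, hh⟩ : Fin n) = i := Fin.ext hlev
      rw [this]
      simp

/-- The selection of a path is feasible: `Σ a_i y_i ≤ b`. [cite: ConfortiCornuejolsZambelli2013, Thm. 7.1 (p. 34)] -/
theorem selSum_selOf_le {v : Fin (n + 1) → KState n b} (hp : IsPathIn (dag w b) ⟨n, v⟩) :
    selSum w (selOf v) ≤ b := by
  have h := weight_of_isPathIn hp (Fin.last n)
  rw [Fin.val_last, psum_eq_selSum] at h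
  have := (v (Fin.last n)).2.1.isLt
  omega

/-- A path projects to the characteristic vector of its selection. [cite: ConfortiCornuejolsZambelli2013, Thm. 7.1 (p. 34)] -/
theorem proj_pathVec_eq_assignVec {v : Fin (n + 1) → KState n b} (hp : IsPathIn (dag w b) ⟨n, v⟩) :
    proj n b (pathVec ⟨n, v⟩) = assignVec (selOf v) := by
  classical
  have hinj : Injective v := injective_of_graded (rk := fun x : KState n b => x.1.val) (p := ⟨n, v⟩)
    fun i => dag_graded w b _ _ ((isPathIn_iff.1 hp).2.1 i)
  funext k
  rw [proj_pathVec v hinj k, Literature.Barriers.PneNP.assignVec_apply, Finset.sum_eq_single k]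
  · have hlev := level_of_isPathIn hp k.succ
    simp only [Fin.val_succ] at hlev
    simp only [hlev, true_and]
    rfl
  · intro i _ hik
    have hlev := level_of_isPathIn hp i.succ
    simp only [Fin.val_succ] at hlev
    rw [if_neg]
    rintro ⟨h1, -⟩
    exact hik (Fin.ext (by omega))
  · intro hk; exact absurd (mem_univ k) hk

/-- The path of a selection `y`: nodes `(i, Σ_{j<i} [y_j] a_j, y_{i−1})`. [cite: ConfortiCornuejolsZambelli2013, §7.1 (p. 34: "a path `P` … from `v_{0,0}`")] -/
def pathOf (w : Fin n → ℕ) (y : Fin n → Bool) (hy : selSum w y ≤ b) : Fin (n + 1) → KState n b :=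
  fun i => (i, ⟨psum w y i.val, Nat.lt_succ_of_le ((psum_le_selSum w y i.val).trans hy)⟩,
    Fin.cases false (fun k => y k) i)

/-- **Solution ⇒ path**: the path of a feasible selection is an `s`–`t` path of the DP digraph.
[cite: ConfortiCornuejolsZambelli2013, §7.1, Thm. 7.1 (p. 34)] -/
theorem isPathIn_pathOf (w : Fin n → ℕ) (y : Fin n → Bool) (hy : selSum w y ≤ b) :
    IsPathIn (dag w b) ⟨n, pathOf w y hy⟩ := by
  refine isPathIn_iff.2 ⟨?_, fun i => ?_, ?_⟩
  · rw [mem_dag, isArc_srcA]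
    simp only [pathOf, Fin.cases_zero]
    refine Prod.ext rfl (Prod.ext (Fin.ext ?_) rfl)
    simp [psum_zero]
  · rw [mem_dag, isArc_arcA]
    simp only [pathOf, Fin.val_castSucc, Fin.val_succ, Fin.cases_succ, true_and]
    rw [psum_succ]
    cases hyi : y i
    · left; exact ⟨rfl, by simp⟩
    · right; exact ⟨rfl, i.isLt, by simp⟩
  · rw [mem_dag, isArc_snkA]
    simp [pathOf]

/-- The selection of the path of `y` is `y`. [cite: ConfortiCornuejolsZambelli2013, §7.1 (p. 34)] -/
theorem selOf_pathOf (w : Fin n → ℕ) (y : Fin n → Bool) (hy : selSum w y ≤ b) :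
    selOf (pathOf w y hy) = y := by
  funext k
  simp [selOf, pathOf]

/-- **"`x_k = 1` if `P ∩ A_k ≠ ∅`", as a set identity**: the `s`–`t` paths of the DP digraph project
exactly onto the characteristic vectors of the feasible selections.
[cite: ConfortiCornuejolsZambelli2013, §7.1, Thm. 7.1 (p. 34)] -/
theorem proj_image_pathVecs (w : Fin n → ℕ) (b : ℕ) :
    proj n b '' {q | ∃ p : GPath (KState n b), IsPathIn (dag w b) p ∧ q = pathVec p} =
      {x | ∃ y : Fin n → Bool, selSum w y ≤ b ∧ x = assignVec y} := by
  apply Set.Subset.antisymm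
  · rintro _ ⟨_, ⟨⟨m, v⟩, hp, rfl⟩, rfl⟩
    have hm := len_of_isPathIn hp
    subst hm
    exact ⟨selOf v, selSum_selOf_le hp, proj_pathVec_eq_assignVec hp⟩
  · rintro x ⟨y, hy, rfl⟩
    refine ⟨pathVec ⟨n, pathOf w y hy⟩, ⟨⟨n, pathOf w y hy⟩, isPathIn_pathOf w y hy, rfl⟩, ?_⟩
    rw [proj_pathVec_eq_assignVec (isPathIn_pathOf w y hy), selOf_pathOf]

/-! ## §4. Theorem 7.1: the extended formulation and its size -/

/-- **Theorem 7.1 (items indexed by `Fin n`)**: `xc(KNAPSACK) ≤ |arcs| ≤ 8(n+1)(b+1)`.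
[cite: ConfortiCornuejolsZambelli2013, §7.1, Thm. 7.1 (p. 34)] -/
theorem hasEFOfSize_knapsackPolytope_fin (w : Fin n → ℕ) (b : ℕ) :
    ∃ r : ℕ, r ≤ 8 * (n + 1) * (b + 1) ∧ HasEFOfSize (knapsackPolytope w b) r :=
  ⟨(dag w b).card, card_dag_le w b,
    hasEFOfSize_convexHull_of_pathImage (dag w b) (fun x : KState n b => x.1.val) (dag_graded w b)
      (proj n b) _ (proj_image_pathVecs w b)⟩

/-- Reindexing the items along `e : A ≃ Fin n`: `selSum (a ∘ e⁻¹) y' = selSum a (y' ∘ e)`.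
[cite: ConfortiCornuejolsZambelli2013, §5.3 (p. 20: `K(n,b)`)] -/
theorem selSum_comp_equiv {A : Type} [Fintype A] (a : A → ℕ) (e : A ≃ Fin n) (y' : Fin n → Bool) :
    selSum (a ∘ e.symm) y' = selSum a (y' ∘ e) := by
  unfold selSum
  exact (Fintype.sum_equiv e _ _ fun k => by simp).symm

/-- Reindexing the items is a linear change of coordinates of the knapsack polytope.
[cite: ConfortiCornuejolsZambelli2013, §5.3 (p. 20)] -/
theorem knapsackPolytope_eq_image {A : Type} [Fintype A] (a : A → ℕ) (b : ℕ) (e : A ≃ Fin n) :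
    knapsackPolytope a b = LinearMap.funLeft ℝ ℝ e '' knapsackPolytope (a ∘ e.symm) b := by
  unfold knapsackPolytope
  rw [LinearMap.image_convexHull]
  congr 1
  apply Set.Subset.antisymm
  · rintro x ⟨y, hy, rfl⟩
    refine ⟨assignVec (y ∘ e.symm), ⟨y ∘ e.symm, ?_, rfl⟩, ?_⟩
    · rw [selSum_comp_equiv]
      simpa [Function.comp_def] using hy
    · funext k
      simp [LinearMap.funLeft_apply, Literature.Barriers.PneNP.assignVec_apply]
  · rintro _ ⟨_, ⟨y', hy', rfl⟩, rfl⟩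
    refine ⟨y' ∘ e, by rwa [← selSum_comp_equiv], ?_⟩
    funext k
    simp [LinearMap.funLeft_apply, Literature.Barriers.PneNP.assignVec_apply]

/-- **Conforti–Cornuéjols–Zambelli 2013, Theorem 7.1 — PROVED, with the pseudo-polynomial size**:
for any finite item set `A`, weights `a : A → ℕ` and capacity `b`, `xc(KNAPSACK(A,b)) ≤ 8(|A|+1)(b+1)`.
[cite: ConfortiCornuejolsZambelli2013, §7.1, Thm. 7.1 (p. 34)] -/
theorem ConfortiCornuejolsZambelli2013_thm71 {A : Type} [Fintype A] (a : A → ℕ) (b : ℕ) :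
    ∃ r : ℕ, r ≤ 8 * (Fintype.card A + 1) * (b + 1) ∧ HasEFOfSize (knapsackPolytope a b) r := by
  obtain ⟨r, hr, hEF⟩ := hasEFOfSize_knapsackPolytope_fin (a ∘ (Fintype.equivFin A).symm) b
  refine ⟨r, hr, ?_⟩
  rw [knapsackPolytope_eq_image a b (Fintype.equivFin A)]
  exact hEF.image_linearMap _

/-- **The subset-sum polytope too** (`SUBSETSUM(A,b)` is a face of `KNAPSACK(A,b)`):
`xc(SUBSETSUM(A,b)) ≤ 8(|A|+1)(b+1)`. [cite: ConfortiCornuejolsZambelli2013, Thm. 7.1 (p. 34)] [cite: AvisTiwary2015, §3.2 with Prop. 2 (arXiv pp. 6, 9)] -/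
theorem hasEFOfSize_subsetSumPolytope {A : Type} [Fintype A] (a : A → ℕ) (b : ℕ) :
    ∃ r : ℕ, r ≤ 8 * (Fintype.card A + 1) * (b + 1) ∧ HasEFOfSize (subsetSumPolytope a b) r := by
  obtain ⟨r, hr, hEF⟩ := ConfortiCornuejolsZambelli2013_thm71 a b
  exact ⟨r, hr, hEF.subsetSum_of_knapsack⟩

open Literature.Barriers.PneNP in
/-- **Extension-complexity lower bounds for knapsack need exponentially large weights**: in the
Avis–Tiwary instances (`10(n+1)² − 8(n+1)` items, every EF of size `≥ (3/2)ⁿ − 1`,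
`AvisTiwary2015_cor2`) the capacity `b` satisfies `(3/2)ⁿ ≤ 8·(10(n+1)²−8(n+1)+1)·(b+1) + 1`.
[cite: AvisTiwary2015, Cor. 2 (arXiv p. 9)] [cite: ConfortiCornuejolsZambelli2013, Thm. 7.1 (p. 34)] -/
theorem AvisTiwary2015_target_exponential (n : ℕ) :
    (3 / 2 : ℝ) ^ n ≤ 8 * ((10 * (n + 1) ^ 2 - 8 * (n + 1) : ℕ) + 1) *
      ((SubsetSumSat.target (SatCut.formula (n + 1)) : ℝ) + 1) + 1 := by
  obtain ⟨hcard, -, hknap⟩ := AvisTiwary2015_cor2 n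
  obtain ⟨r, hr, hEF⟩ := ConfortiCornuejolsZambelli2013_thm71
    (SubsetSumSat.weight (SatCut.formula (n + 1))) (SubsetSumSat.target (SatCut.formula (n + 1)))
  have h1 := hknap r hEF
  rw [hcard] at hr
  have hr' : (r : ℝ) ≤ 8 * ((10 * (n + 1) ^ 2 - 8 * (n + 1) : ℕ) + 1) *
      ((SubsetSumSat.target (SatCut.formula (n + 1)) : ℝ) + 1) := by exact_mod_cast hr
  linarith

end KnapsackEF

end Literature.Combinatorics.Optimization

end
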